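import Summits.QuantumFields.YangMills.Theorems.IR.EsPolymerDecoupling

/-!
# Crux `IR` (stmt-QuantumFields-19354) — line «es-polymer-decoupling»: the ALL-RADIUS («region») form of the
decoupling–polymer format (ideator ym-ir-idea-1 g6; answer to the lead's STUB-MISSTATED on `stub_polymerEngine`,
2026-08-28T02:23Z)

**The defect (lead ym-ir-line-mxc-p1 g2, confirmed).**  `GapInUnits` fixes `β₂, S₁` BEFORE the species `A B : YMSpecies G`
(arbitrary finite lattice supports; only the constant `C` may depend on them), while the clauses (I)(D) of `DPR ρ β S b p`
(`Theorems/IR/EsPolymerDefs.lean`) speak only of observables on RADIUS-1 cell blocks at the one mesh `b(β) = ⌈ℓ/a β⌉₊`.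
For `β ∈ [β₂, β_A)` — before the support of `A` fits into a radius-1 block — no clause mentions `A`, yet decay
`|corr_β(n)| ≤ C e^{-c₁ a(β) n}` for ALL `n ≤ S`, `S → ∞`, is demanded: `PolymerEngine` as typed is not derivable from the
format (pairwise independence of radius-1 block observables does not even control products over many blocks).

**The repair, typed (this file; sorry-free; nothing registered).**  Clauses (I)(D) for block observables of EVERY cell
radius `k`, with the decoupling hypothesis stated as DISJOINTNESS OF THE NEAR-POLYMER SETS
`nearSet Γ c k = {γ ∈ Γ : γ comes within cell-distance k+1 of c}` (block radius `k` + plaquette reach `1`), NOT as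
inequality of owner-unions: for `k ≥ 3` the hard core `7` no longer makes the near-set a subsingleton, and two blocks with
near-sets `{γ₁, γ₂} ≠ {γ₂, γ₃}` share `γ₂` — the Kandel–Domany measure `ν_Γ` does NOT decouple them, so an
«`owner_k Γ c_A ≠ owner_k Γ c_B`» clause would make the weak-coupling load false already at strong coupling.  Separation
`k_A + k_B + 2 ≤ cellDist c_A c_B` (one full cell between the blocks — never adjacent, as in the radius-1 format, where it
reads `4 ≤ cellDist`).  In the Edwards–Sokal / Kandel–Domany construction at strong coupling the all-radius clauses are
FREE (the integrand factorises over polymers with pairwise disjoint link sets; a block observable integrates against the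
polymers near it only), so the rung keeps its proof plan; the engine now serves every species at its own (β-uniformly
bounded) block radius `k_A ≤ R_A`.

* §1 `nearSet`; under `Compatible`, `nearSet Γ c 1` is `∅` or a singleton and `owner Γ c = (nearSet Γ c 1).sup id`.
* §2 `DPRreg ρ β S b p` (clauses (P), (I_reg), (D_reg)), `DPRregInUnits`; **`dpr_of_dprReg : DPRreg → DPR`** (the re-cut
  is a STRENGTHENING of the format: the radius-1 clauses are the case `k_A = k_B = 1`).
* §3 `PolymerEngineReg`, `IRPolymerCertReg`, `ESRungReg` and the directions
  `PolymerEngine → PolymerEngineReg` (the new engine stub is WEAKER than the misstated one — it assumes more),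
  `IRPolymerCertReg → IRPolymerCert`, `ESRungReg → ESRung` (the old stubs become corollaries; old decls stay as settled text).
* §4 `ir_of_polymerReg : PolymerEngineReg → IRPolymerCertReg → BalabanLadder.IR` — the line still concludes the route
  decl BY NAME.

Intended stub set after the re-cut (the LEAD decides and registers; ruling g9-№1): `stub_polymerEngineReg : PolymerEngineReg`
(L; Kotecký–Preiss two-point truncation of the hard-core cell gas + Peierls + the landed reduction `abs_cov_sub_gasCov_le`
restated for regions), `stub_polymerCertReg : IRPolymerCertReg` (XL, width 0, census class UNCHANGED: EQUIV-or-stronger than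
the leaf, B5 wall in polymer clothes — NOT staffed), `stub_esRungReg : ESRungReg` (mesh 1, all radii; imports
`KandelDomanyRepresentation`).  The defs below live in the sub-namespace `RegionForm` so that the lead can lift them
verbatim into `Theorems/IR/EsPolymerDefs.lean` (append-only) without a name clash.

HONEST FRAMING: a re-typing of ONE line's format for ONE open gap-crux of a CONDITIONAL chain (R4 closes only the finite-𝕋⁴
UV rung `BalabanLadder.UV`); every `def … : Prop` is a hypothesis a stub proves or consumes; nothing here proves a polymer
representation at weak coupling, a lattice mass gap, or the Clay Yang–Mills problem.
-/

set_option autoImplicit false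

noncomputable section

open Filter Topology MeasureTheory Finset
open Literature.MathematicalPhysics.QuantumFieldTheory Literature.MathematicalPhysics.QuantumLattice
open Summit.QuantumFields.YangMills.Cruxes.OSLegsFromFemtoAndGap.DlrCollarTransfer (GapInUnits LowerBounds)

namespace Summit.QuantumFields.YangMills.Cruxes.IR.EsPolymer

namespace RegionForm

/-! ## §1 Near-polymer sets -/

/-- The polymers of the family `Γ` that come within cell-distance `k + 1` of `c`, i.e. within plaquette reach of the block
of cell-radius `k` about `c`.  For `k = 1` this is the filter whose union is `owner Γ c`. -/
def nearSet {q : ℕ} (Γ : Finset (Finset (Cell q))) (c : Cell q) (k : ℕ) : Finset (Finset (Cell q)) :=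
  Γ.filter fun γ => ∃ c' ∈ γ, cellDist c c' ≤ k + 1

variable {q : ℕ}

theorem mem_nearSet {Γ : Finset (Finset (Cell q))} {c : Cell q} {k : ℕ} {γ : Finset (Cell q)} :
    γ ∈ nearSet Γ c k ↔ γ ∈ Γ ∧ ∃ c' ∈ γ, cellDist c c' ≤ k + 1 := by
  unfold nearSet; exact mem_filter

theorem nearSet_subset (Γ : Finset (Finset (Cell q))) (c : Cell q) (k : ℕ) : nearSet Γ c k ⊆ Γ :=
  filter_subset _ _

/-- The owner is the union of the radius-1 near-set (definitionally). -/
theorem owner_eq_sup_nearSet (Γ : Finset (Finset (Cell q))) (c : Cell q) :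
    owner Γ c = (nearSet Γ c 1).sup id := rfl

/-- Under compatibility (hard core `7`) at most ONE polymer comes within cell-distance `2` of a cell. -/
theorem nearSet_one_subsingleton {Γ : Finset (Finset (Cell q))} (hΓ : Compatible Γ) (c : Cell q) :
    ∀ γ₁ ∈ nearSet Γ c 1, ∀ γ₂ ∈ nearSet Γ c 1, γ₁ = γ₂ := by
  intro γ₁ h₁ γ₂ h₂
  rw [mem_nearSet] at h₁ h₂
  by_contra hne
  obtain ⟨c₁, hc₁, hd₁⟩ := h₁.2
  obtain ⟨c₂, hc₂, hd₂⟩ := h₂.2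
  have h7 := hΓ.2 γ₁ h₁.1 γ₂ h₂.1 hne c₁ hc₁ c₂ hc₂
  have htri := cellDist_triangle c₁ c c₂
  rw [cellDist_comm c₁ c] at htri
  omega

/-- Under compatibility the radius-1 near-set is empty or a singleton `{γ}` with `γ ∈ Γ` a (nonempty) polymer. -/
theorem nearSet_one_eq {Γ : Finset (Finset (Cell q))} (hΓ : Compatible Γ) (c : Cell q) :
    nearSet Γ c 1 = ∅ ∨ ∃ γ ∈ Γ, γ.Nonempty ∧ nearSet Γ c 1 = {γ} := by
  rcases (nearSet Γ c 1).eq_empty_or_nonempty with h | ⟨γ, hγ⟩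
  · exact Or.inl h
  · have hγΓ : γ ∈ Γ := (mem_nearSet.1 hγ).1
    exact Or.inr ⟨γ, hγΓ, (hΓ.1 γ hγΓ).1,
      eq_singleton_iff_unique_mem.2 ⟨hγ, fun γ' h' => nearSet_one_subsingleton hΓ c γ' h' γ hγ⟩⟩

theorem owner_eq_empty_of_nearSet {Γ : Finset (Finset (Cell q))} {c : Cell q} (h : nearSet Γ c 1 = ∅) :
    owner Γ c = ∅ := by
  rw [owner_eq_sup_nearSet, h, sup_empty, bot_eq_empty]

theorem owner_eq_of_nearSet {Γ : Finset (Finset (Cell q))} {c : Cell q} {γ : Finset (Cell q)}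
    (h : nearSet Γ c 1 = {γ}) : owner Γ c = γ := by
  rw [owner_eq_sup_nearSet, h, sup_singleton, id]

/-! ## §2 The all-radius format -/

section Measure

variable {G : Type} [Group G] [TopologicalSpace G] [IsTopologicalGroup G] [CompactSpace G]
  [MeasurableSpace G] [BorelSpace G]

/-- **`DPRreg ρ β S b p` — decoupling–polymer representation, ALL-RADIUS form.**  Same data and clause (P) as `DPR`;
(I_reg): under `ν_Γ` (Γ compatible), bounded measurable observables on the blocks of cell-radii `k_A, k_B` about `c_A, c_B`,
the blocks separated by at least one full cell (`k_A + k_B + 2 ≤ cellDist c_A c_B`) and NO polymer of `Γ` near both blocks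
(`Disjoint (nearSet Γ c_A k_A) (nearSet Γ c_B k_B)`), are exactly independent; (D_reg): the `ν_Γ`-mean of a radius-`k`
block observable is `ν_Γ(1) · Φ (nearSet Γ c k)` for a function `Φ` of the near-polymer set alone. -/
def DPRreg {n : ℕ} (ρ : G →* Matrix (Fin n) (Fin n) ℂ) (β : ℝ) (S b : ℕ) (p : ℝ) : Prop :=
  ∃ (q : ℕ) (w : Fin 4 → ℤ → ℤ), IsGrid (2 * S + 1) b q w ∧
    ∃ (act : Finset (Cell q) → ℝ) (Z : ℝ)
      (ν : Finset (Finset (Cell q)) → Measure (GaugeConfig 4 (2 * S + 1) G)),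
      0 < Z ∧ (∀ γ, 0 ≤ act γ ∧ act γ ≤ p ^ γ.card) ∧
      (∀ Γ, ¬ Compatible Γ → ν Γ = 0) ∧
      (Finset.univ.sum ν = wilsonMeasure (d := 4) (L := 2 * S + 1) ρ β) ∧
      (∀ Γ, Compatible Γ → (ν Γ Set.univ).toReal = Z⁻¹ * ∏ γ ∈ Γ, act γ) ∧
      (∀ Γ, Compatible Γ → ∀ (cA cB : Cell q) (kA kB : ℕ) (A B : GaugeConfig 4 (2 * S + 1) G → ℝ),
          Measurable A → Measurable B → (∃ C, ∀ U, |A U| ≤ C) → (∃ C, ∀ U, |B U| ≤ C) →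
          DependsOn A (blockEdges (2 * S + 1) q w cA kA) → DependsOn B (blockEdges (2 * S + 1) q w cB kB) →
          kA + kB + 2 ≤ cellDist cA cB → Disjoint (nearSet Γ cA kA) (nearSet Γ cB kB) →
            (ν Γ Set.univ).toReal * ∫ U, A U * B U ∂(ν Γ) = (∫ U, A U ∂(ν Γ)) * (∫ U, B U ∂(ν Γ))) ∧
      (∀ (cA : Cell q) (kA : ℕ) (A : GaugeConfig 4 (2 * S + 1) G → ℝ), Measurable A → (∃ C, ∀ U, |A U| ≤ C) →
          DependsOn A (blockEdges (2 * S + 1) q w cA kA) →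
            ∃ Φ : Finset (Finset (Cell q)) → ℝ, ∀ Γ, Compatible Γ →
              ∫ U, A U ∂(ν Γ) = (ν Γ Set.univ).toReal * Φ (nearSet Γ cA kA))

/-- **The re-cut is a strengthening of the format: `DPRreg → DPR`** (the radius-1 clauses are the case `k_A = k_B = 1`:
under compatibility «different owners or both unowned» is exactly «disjoint radius-1 near-sets», and a function of the owner
is a function of the near-set). -/
theorem dpr_of_dprReg {n : ℕ} (ρ : G →* Matrix (Fin n) (Fin n) ℂ) (β : ℝ) (S b : ℕ) (p : ℝ)
    (h : DPRreg ρ β S b p) : DPR ρ β S b p := by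
  classical
  obtain ⟨q, w, hgrid, act, Z, ν, hZ, hP, hν0, hsum, hmass, hI, hD⟩ := h
  refine ⟨q, w, hgrid, act, Z, ν, hZ, hP, hν0, hsum, hmass, ?_, ?_⟩
  · intro Γ hΓ cA cB A B hAm hBm hAb hBb hAd hBd hdist hown
    refine hI Γ hΓ cA cB 1 1 A B hAm hBm hAb hBb hAd hBd (by omega) ?_
    rw [Finset.disjoint_left]
    intro γ hA hB
    have hA1 : nearSet Γ cA 1 = {γ} :=
      eq_singleton_iff_unique_mem.2 ⟨hA, fun γ' h' => nearSet_one_subsingleton hΓ cA γ' h' γ hA⟩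
    have hB1 : nearSet Γ cB 1 = {γ} :=
      eq_singleton_iff_unique_mem.2 ⟨hB, fun γ' h' => nearSet_one_subsingleton hΓ cB γ' h' γ hB⟩
    have hoA : owner Γ cA = γ := owner_eq_of_nearSet hA1
    have hoB : owner Γ cB = γ := owner_eq_of_nearSet hB1
    have hne : γ ≠ ∅ := (hΓ.1 γ ((mem_nearSet.1 hA).1)).1.ne_empty
    rcases hown with h | ⟨h, -⟩
    · exact h (hoA.trans hoB.symm)
    · exact hne (hoA ▸ h)
  · intro cA A hAm hAb hAd
    obtain ⟨Φ, hΦ⟩ := hD cA 1 A hAm hAb hAd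
    refine ⟨fun o => if o = ∅ then Φ ∅ else Φ {o}, fun Γ hΓ => ?_⟩
    rw [hΦ Γ hΓ]
    congr 1
    rcases nearSet_one_eq hΓ cA with h | ⟨γ, -, hγne, h⟩
    · rw [h, owner_eq_empty_of_nearSet h]; beta_reduce; rw [if_pos rfl]
    · rw [h, owner_eq_of_nearSet h]; beta_reduce; rw [if_neg hγne.ne_empty]

/-- The all-radius representation in physical units with Peierls parameter `p`: at some physical mesh `ℓ`, for all large
`β` and all large tori (shape of `DPRInUnits`). -/
def DPRregInUnits (r : LatticeRep G) (a : ℝ → ℝ) (p : ℝ) : Prop :=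
  ∃ (ℓ β₂ : ℝ) (S₁ : ℝ → ℕ), 0 < ℓ ∧ ∀ β : ℝ, β₂ ≤ β → ∀ S : ℕ, S₁ β ≤ S → DPRreg r.ρ β S ⌈ℓ / a β⌉₊ p

theorem dprInUnits_of_reg (r : LatticeRep G) (a : ℝ → ℝ) (p : ℝ) (h : DPRregInUnits r a p) :
    DPRInUnits r a p := by
  obtain ⟨ℓ, β₂, S₁, hℓ, h⟩ := h
  exact ⟨ℓ, β₂, S₁, hℓ, fun β hβ S hS => dpr_of_dprReg _ _ _ _ _ (h β hβ S hS)⟩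

end Measure

/-! ## §3 Engine, load and rung in the all-radius form, with the directions to the radius-1 statements -/

/-- **ENGINE, all-radius form (provable: Kotecký–Preiss two-point truncation of the hard-core cell gas + Peierls + the
reduction of covariances to the gas, for block observables of ANY radius).**  A species `A` of lattice support radius `R_A`
is served at block radius `k_A(β) = ⌈R_A / b(β)⌉₊ ≤ R_A`, uniformly in `β ≥ β₂`; the near-both-blocks Peierls event costs
`≤ (2k_A+3)⁴ Σ_{m ≥ (n/2b − k_A − k_B − 2)/6} (e 13⁴ p₀)^m`, so the rate `∝ |log (e 13⁴ p₀)|/ℓ · a β` is species-free and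
only the prefactor sees `A, B` — exactly the quantifier order of `GapInUnits`. -/
def PolymerEngineReg : Prop :=
  ∃ p₀ : ℝ, 0 < p₀ ∧
    ∀ (G : Type) [Group G] [TopologicalSpace G] [IsTopologicalGroup G] [CompactSpace G],
      letI : MeasurableSpace G := borel G; haveI : BorelSpace G := ⟨rfl⟩;
      ∀ (r : LatticeRep G) (a : ℝ → ℝ), (∀ β, 0 < a β) → Tendsto a atTop (𝓝 0) →
        DPRregInUnits r a p₀ → GapInUnits G r a

/-- **THE CRUX of R2c in all-radius polymer form** (compact SIMPLE `G`; simplicity load-bearing as for `IRPolymerCert`;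
STRONGER than the leaf — the whole price; NOT staffed). -/
def IRPolymerCertReg : Prop :=
  ∀ (G : Type) [Group G] [TopologicalSpace G] [IsTopologicalGroup G] [CompactSpace G],
    IsCompactSimpleLieGroup G → letI : MeasurableSpace G := borel G; haveI : BorelSpace G := ⟨rfl⟩;
    ∀ (r : LatticeRep G) (a : ℝ → ℝ), (∀ β, 0 < a β) → Tendsto a atTop (𝓝 0) →
      LowerBounds G r a → ∀ p : ℝ, 0 < p → DPRregInUnits r a p

/-- **RUNG, all-radius form (strong coupling, mesh 1, every torus; Kandel–Domany / Edwards–Sokal cell deletion — the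
all-radius clauses are free there: the integrand of `ν_Γ` factorises over polymers with pairwise disjoint link sets).** -/
def ESRungReg : Prop :=
  ∀ (G : Type) [Group G] [TopologicalSpace G] [IsTopologicalGroup G] [CompactSpace G]
    [MeasurableSpace G] [BorelSpace G] (n : ℕ) (ρ : G →* Matrix (Fin n) (Fin n) ℂ), Continuous ρ →
    ∀ p : ℝ, 0 < p → ∃ β₀ : ℝ, 0 < β₀ ∧ ∀ β : ℝ, |β| ≤ β₀ → ∀ S : ℕ, DPRreg ρ β S 1 p

/-- The new engine statement is WEAKER than the misstated one (it assumes the stronger format). -/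
theorem polymerEngineReg_of_polymerEngine (h : PolymerEngine) : PolymerEngineReg := by
  obtain ⟨p₀, hp₀, h⟩ := h
  refine ⟨p₀, hp₀, ?_⟩
  intro G _ _ _ _
  letI : MeasurableSpace G := borel G
  haveI : BorelSpace G := ⟨rfl⟩
  intro r a ha ha0 hrep
  exact h G r a ha ha0 (dprInUnits_of_reg r a p₀ hrep)

/-- The new load implies the old one. -/
theorem irPolymerCert_of_reg (h : IRPolymerCertReg) : IRPolymerCert := by
  intro G _ _ _ _ hG
  letI : MeasurableSpace G := borel G
  haveI : BorelSpace G := ⟨rfl⟩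
  intro r a ha ha0 hlb p hp
  exact dprInUnits_of_reg r a p (h G hG r a ha ha0 hlb p hp)

/-- The new rung implies the old one. -/
theorem esRung_of_reg (h : ESRungReg) : ESRung := by
  intro G _ _ _ _ _ _ n ρ hρ p hp
  obtain ⟨β₀, hβ₀, h⟩ := h G n ρ hρ p hp
  exact ⟨β₀, hβ₀, fun β hβ S => dpr_of_dprReg _ _ _ _ _ (h β hβ S)⟩

/-! ## §4 The composition concluding `BalabanLadder.IR` BY NAME -/

/-- Engine + load ⇒ `IRCal` (the load is applied at the engine's threshold `p₀`). -/
theorem irCal_of_polymerReg (hE : PolymerEngineReg) (hC : IRPolymerCertReg) : IRCal := by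
  obtain ⟨p₀, hp₀, hE⟩ := hE
  intro G _ _ _ _ hG
  letI : MeasurableSpace G := borel G
  haveI : BorelSpace G := ⟨rfl⟩
  intro r a ha ha0 hlb
  exact hE G r a ha ha0 (hC G hG r a ha ha0 hlb p₀ hp₀)

/-- **Engine + load ⇒ the route decl `BalabanLadder.IR` BY NAME** (the re-cut skeleton's `IR_of` would be
`ir_of_polymerReg stub_polymerEngineReg stub_polymerCertReg`). -/
theorem ir_of_polymerReg (hE : PolymerEngineReg) (hC : IRPolymerCertReg) :
    Summit.QuantumFields.YangMills.Theses.BalabanLadder.IR := by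
  have h : IRCal := irCal_of_polymerReg hE hC
  delta Summit.QuantumFields.YangMills.Theses.BalabanLadder.IR
  delta Summit.QuantumFields.YangMills.Cruxes.IR.EsPolymer.IRCal at h
  exact h

end RegionForm

end Summit.QuantumFields.YangMills.Cruxes.IR.EsPolymer

end
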